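import Mathlib
import HarnessLib
import Summits.NavierStokesRegularity.NavierStokesRegularity.Theorems.PoloidalWindowDoorPoloidalWindowRigidityTimeShearVariance
import Summits.NavierStokesRegularity.NavierStokesRegularity.Theorems.PoloidalWindowDoorPoloidalWindowRigidityTimeHeightShearWeight

/-!
# Route `PoloidalWindowDoor`, crux `PoloidalWindowRigidity` (K2, stmt-NavierStokesRegularity-19708) — line «lrc-jet» v4,
# stub `stub_timeHeightShear`, STEP 2, brick 1: the HORIZONTAL-VARIANCE LAW of (TH) with its two new source terms (TH-KEY)

Cell ns-regularity-ideate, seat ns-poloidal-K2-p2 gen 4 (stub-worker under the K2 lead ns-poloidal-K2-p1 g5; `--supports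
stmt-NavierStokesRegularity-19708 --as helper`; brief BRIEF-stub_timeHeightShear.md STEP 2; seat note TH-STEP2.md = evidence #50).
ns-poloidal-K2-p3's `…TimeShearVariance.key_slice_TV` re-run on the (TH) normal form `∂₂v_b(s,y) = μ(s,y₂)∂_b v₂(s,y)`
(`…TimeHeightShearNormalForm`) with the K2 lead's pressure law p530500 in the integrated form of
`…TimeHeightShearWeight.horizFDeriv_weightSource_eq_zero`: `F := f₂ − Λ[(μ_t−μ_zz)v₂ + (μ_z/2)v₂² − 2μ_z∂₂v₂]` is
HEIGHT-ONLY (`residual_TH_eq_of_height_eq`), so K2-p2's `…SeparatedShearEnergy.key_mean_sep` applies with the slot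
`θt := ∂ₜv₂ − Λ[…]`, whose coefficients are constant on every horizontal plane (`hmean_height_mul`).  Result `key_slice_TH`:
`∂ₜV − 2Λ(μ_t−μ_zz)V − Λμ_z(⟨v₂³⟩ − ⟨v₂⟩⟨v₂²⟩) + 4Λμ_z(⟨v₂∂₂v₂⟩ − ⟨v₂⟩⟨∂₂v₂⟩) + 2∂_zG + 2Dsep ≤ R⁻¹(8M₀³ + 8M₀M₁)K` — the
(TV) law plus the brief's two located sources, the cubic central moment `Λμ_z Cov(v₂²,v₂)` (removable by the weight `1−μ`,
TH-STEP2 §2) and the vertical transport `−4Λμ_z Cov(∂₂v₂,v₂) = −2Λμ_z∂_zV + O(1/R)`; `sliceDsep_nonneg_TH`: the production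
`(1−μ)|∇_h v₂|²` is `≥ 0` for `μ ≤ 1`.  WHAT THIS IS NOT: not NS regularity and not the stub — by TH-STEP2 §3 the (TV) endgame
does not transfer (`𝓛[(1−μ)v₂] = A − (μ_z/2)v₂²`), so this exact law yields large-scale homogenisation under smallness only.
-/

noncomputable section

-- the summit and its single sub-problem share the name (CONVENTIONS §1), as in every Theorems file
set_option linter.dupNamespace false

namespace Summit.NavierStokesRegularity.NavierStokesRegularity.Theorems.PoloidalWindowDoorPoloidalWindowRigidityTimeHeightShearVariance

open MeasureTheory Set Function Filter Topology Metric InnerProductSpace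
open scoped RealInnerProductSpace InnerProductSpace Laplacian ContDiff
open Literature.Analysis Literature.Analysis.FluidPDE
open Summit.NavierStokesRegularity.NavierStokesRegularity.Theorems.PoloidalWindowDoorPoloidalWindowRigidityWindow
open Summit.NavierStokesRegularity.NavierStokesRegularity.Theorems.PoloidalWindowDoorPoloidalWindowRigidityHorizontalMean
open Summit.NavierStokesRegularity.NavierStokesRegularity.Theorems.PoloidalWindowDoorPoloidalWindowRigidityConstantShearMeans
open Summit.NavierStokesRegularity.NavierStokesRegularity.Theorems.PoloidalWindowDoorPoloidalWindowRigidityConstantShearSlice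
open Summit.NavierStokesRegularity.NavierStokesRegularity.Theorems.PoloidalWindowDoorPoloidalWindowRigidityConstantShearVariance
open Summit.NavierStokesRegularity.NavierStokesRegularity.Theorems.PoloidalWindowDoorPoloidalWindowRigiditySeparatedShearEnergy
open Summit.NavierStokesRegularity.NavierStokesRegularity.Theorems.PoloidalWindowDoorPoloidalWindowRigiditySeparatedShearVariance
open Summit.NavierStokesRegularity.NavierStokesRegularity.Theorems.PoloidalWindowDoorPoloidalWindowRigidityTimeHeightShearPressure
open Summit.NavierStokesRegularity.NavierStokesRegularity.Theorems.PoloidalWindowDoorPoloidalWindowRigidityTimeHeightShearWeight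
open Summit.NavierStokesRegularity.NavierStokesRegularity.Theorems.PoloidalWindowDoorPoloidalWindowRigidityVelocityGradientLaw
open Summit.NavierStokesRegularity.NavierStokesRegularity.Theorems.PoloidalWindowDoorPoloidalWindowRigidityMaterialLeibniz
open Summit.NavierStokesRegularity.NavierStokesRegularity.Theorems.LocalSineTubeDoorProfileAlignedWindowRigidityAncient

variable {φ : ContDiffBump (0 : EuclideanSpace ℝ (Fin 2))} {R : ℝ}
  {v : ℝ → EuclideanSpace ℝ (Fin 3) → EuclideanSpace ℝ (Fin 3)} {C : ℝ}

/-- A factor depending on the height only leaves the horizontal mean at height `z` (base point `0`):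
`⟨k(x₂)·G⟩_z = k(z)·⟨G⟩_z`. -/
theorem hmean_height_mul (k : ℝ → ℝ) (G : EuclideanSpace ℝ (Fin 3) → ℝ) (z : ℝ) :
    hmean φ 0 R z (fun x => k (x 2) * G x) = k z * hmean φ 0 R z G := by
  have h : ∀ y, (fun x => k (x 2) * G x) (pt 0 R z y) = k z * G (pt 0 R z y) := by
    intro y
    simp only [pt_apply_two]
    simp
  unfold hmean
  simp_rw [h, mul_assoc, integral_const_mul]

section Class

variable (hrate : HasTypeITimeDecay C v) (hcont : ContinuousOn (uncurry v) (Iio (0 : ℝ) ×ˢ univ))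
  (hmild : ∀ s t : ℝ, s < t → t < 0 → ∀ x,
    v t x = UnboundedOperators.heatExtension (v s) (t - s) x - oseenDuhamel 1 s v v t x)
  (hdiv : ∀ t < 0, VectorCalculus.IsDivFree (v t))
  (hpol : ∀ s < 0, ∀ y, ⟪curl (v s) y, EuclideanSpace.single 2 1⟫_ℝ = 0)
  {μ : ℝ → ℝ → ℝ} (hμ : ContDiff ℝ 3 (uncurry μ))
  (hslope : ∀ s < 0, ∀ y, ∀ b : Fin 3, b ≠ 2 →
    fderiv ℝ (v s) y (EuclideanSpace.single 2 1) b = μ s (y 2) * fderiv ℝ (v s) y (EuclideanSpace.single b 1) 2)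

include hrate hcont hmild hdiv

set_option maxHeartbeats 400000 in
include hpol hμ hslope in
/-- **On (TH), `F := f₂ − Λ[(μ_t − μ_zz)v₂ + (μ_z/2)v₂² − 2μ_z∂₂v₂]` is a function of `x₂` alone** (`Λ = 1/(1−μ(t,x₂))`,
`μ(t,·) < 1`): `F = (2𝒜)/(2(1−μ))` with `∇_h(2𝒜) = 0` (`…TimeHeightShearWeight.horizFDeriv_weightSource_eq_zero`), so `F`
is constant along horizontal segments. -/
theorem residual_TH_eq_of_height_eq {t : ℝ} (ht : t < 0) (hμ1 : ∀ z, μ t z < 1)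
    {x x' : EuclideanSpace ℝ (Fin 3)} (hxx' : x 2 = x' 2) :
    ((timeDerivWithin (Iio 0) v t x + convect (v t) (v t) x - Δ (v t) x) 2 -
        (1 - μ t (x 2))⁻¹ * ((deriv (fun s => μ s (x 2)) t - deriv (deriv (μ t)) (x 2)) * v t x 2 +
          deriv (μ t) (x 2) / 2 * v t x 2 ^ 2 -
          2 * deriv (μ t) (x 2) * fderiv ℝ (v t) x (EuclideanSpace.single 2 1) 2)) =
      ((timeDerivWithin (Iio 0) v t x' + convect (v t) (v t) x' - Δ (v t) x') 2 -
        (1 - μ t (x' 2))⁻¹ * ((deriv (fun s => μ s (x' 2)) t - deriv (deriv (μ t)) (x' 2)) * v t x' 2 +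
          deriv (μ t) (x' 2) / 2 * v t x' 2 ^ 2 -
          2 * deriv (μ t) (x' 2) * fderiv ℝ (v t) x' (EuclideanSpace.single 2 1) 2)) := by
  have hA : IsTypeIAncientMild C v := isTypeIAncientMild_of_class hrate hcont hmild hdiv
  have hs : ContDiff ℝ ∞ (v t) := hA.contDiff_slice ht
  have hsd : Differentiable ℝ (v t) := hs.differentiable (by simp)
  have hμ2 : ContDiff ℝ 2 (uncurry μ) := hμ.of_le (by norm_cast)
  have hμt3 : ContDiff ℝ 3 (μ t) := hμ.comp (contDiff_const.prodMk contDiff_id)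
  have hμt2 : ContDiff ℝ 2 (μ t) := hμt3.of_le (by norm_cast)
  have hμd : Differentiable ℝ (μ t) := hμt2.differentiable (by norm_num)
  have hμ'2 : ContDiff ℝ 2 (deriv (μ t)) :=
    (contDiff_succ_iff_deriv.1 (hμt3 : ContDiff ℝ ((2 : ℕ∞) + 1 : ℕ∞) (μ t))).2.2
  have hμ'd : Differentiable ℝ (deriv (μ t)) := hμ'2.differentiable (by norm_num)
  have hμ''1 : ContDiff ℝ 1 (deriv (deriv (μ t))) :=
    (contDiff_succ_iff_deriv.1 (hμ'2 : ContDiff ℝ ((1 : ℕ∞) + 1 : ℕ∞) (deriv (μ t)))).2.2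
  have hμ''d : Differentiable ℝ (deriv (deriv (μ t))) := hμ''1.differentiable (by norm_num)
  -- the time partial `μ_t(t,·)` as a differentiable function of the height
  obtain ⟨Mt, hMt⟩ : ∃ Mt : ℝ → ℝ, ∀ z, Mt z = deriv (fun s => μ s z) t := ⟨_, fun _ => rfl⟩
  have hMt_eq : Mt = fun z => fderiv ℝ (uncurry μ) (t, z) (1, 0) := funext fun z => by
    rw [hMt]; exact (hasDerivAt_timeSlice_of_uncurry ((hμ2.differentiable (by norm_num)) (t, z))).deriv
  have hMtd : Differentiable ℝ Mt := by
    rw [hMt_eq]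
    exact (((hμ.fderiv_right (m := 2) (by norm_cast)).clm_apply contDiff_const).comp
      (contDiff_const.prodMk contDiff_id)).differentiable (by norm_num)
  set S : EuclideanSpace ℝ (Fin 3) → ℝ := fun y =>
    2 * (1 - μ t (y 2)) * (timeDerivWithin (Iio 0) v t y + convect (v t) (v t) y - Δ (v t) y) 2
      - 2 * (deriv (fun s => μ s (y 2)) t - deriv (deriv (μ t)) (y 2)) * v t y 2
      - deriv (μ t) (y 2) * v t y 2 ^ 2
      + 4 * deriv (μ t) (y 2) * fderiv ℝ (v t) y (EuclideanSpace.single 2 1) 2 with hS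
  set w : EuclideanSpace ℝ (Fin 3) → ℝ := fun y => (2 * (1 - μ t (y 2)))⁻¹ with hw
  set F : EuclideanSpace ℝ (Fin 3) → ℝ := fun y => w y * S y with hF
  have hR : ∀ y, DifferentiableAt ℝ
      (fun y => timeDerivWithin (Iio 0) v t y + convect (v t) (v t) y - Δ (v t) y) y := by
    have h1 : ContDiff ℝ ∞ (timeDerivWithin (Iio 0) v t) := by
      rw [timeDerivWithin_Iio_eq_deriv ht]; exact contDiff_timeDeriv_slice hrate hcont hmild hdiv ht
    have h2 : ContDiff ℝ ∞ (fun y => convect (v t) (v t) y) :=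
      (hs.fderiv_right (m := ∞) (by norm_cast)).clm_apply hs
    have h3 : ContDiff ℝ 1 (Δ (v t)) := contDiff_laplacian (n := 1) (hs.of_le (by norm_cast))
    exact fun y => (((h1.differentiable (by simp)) y).add ((h2.differentiable (by simp)) y)).sub
      ((h3.differentiable (by simp)) y)
  have hF2d : Differentiable ℝ
      (fun y => (timeDerivWithin (Iio 0) v t y + convect (v t) (v t) y - Δ (v t) y) 2) := fun y =>
    ((EuclideanSpace.proj (𝕜 := ℝ) (2 : Fin 3) : EuclideanSpace ℝ (Fin 3) →L[ℝ] ℝ).differentiableAt).comp y (hR y)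
  have hθd : Differentiable ℝ (fun y => v t y 2) := (contDiff_vert hrate hcont hmild hdiv ht).differentiable (by simp)
  have hEd : Differentiable ℝ (fun y => fderiv ℝ (v t) y (EuclideanSpace.single 2 1) 2) :=
    (contDiff_fderiv_coord hrate hcont hmild hdiv ht (EuclideanSpace.single 2 1) 2).differentiable (by simp)
  have hSd : Differentiable ℝ S := by
    have e : S = fun y =>
        2 * (1 - μ t (y 2)) * (timeDerivWithin (Iio 0) v t y + convect (v t) (v t) y - Δ (v t) y) 2
          - 2 * (Mt (y 2) - deriv (deriv (μ t)) (y 2)) * v t y 2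
          - deriv (μ t) (y 2) * v t y 2 ^ 2
          + 4 * deriv (μ t) (y 2) * fderiv ℝ (v t) y (EuclideanSpace.single 2 1) 2 := by
      funext y; rw [hS, hMt]
    rw [e]
    have h1 : Differentiable ℝ (fun y : EuclideanSpace ℝ (Fin 3) => 2 * (1 - μ t (y 2))) :=
      (((contDiff_comp_height hμt2).differentiable (by norm_num)).const_sub 1).const_mul 2
    have hMth : Differentiable ℝ (fun y : EuclideanSpace ℝ (Fin 3) => Mt (y 2)) :=
      hMtd.comp (EuclideanSpace.proj (𝕜 := ℝ) (2 : Fin 3) : EuclideanSpace ℝ (Fin 3) →L[ℝ] ℝ).differentiable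
    have h2 : Differentiable ℝ (fun y : EuclideanSpace ℝ (Fin 3) => 2 * (Mt (y 2) - deriv (deriv (μ t)) (y 2))) :=
      (hMth.sub ((contDiff_comp_height hμ''1).differentiable (by norm_num))).const_mul 2
    have h3 : Differentiable ℝ (fun y : EuclideanSpace ℝ (Fin 3) => deriv (μ t) (y 2)) :=
      (contDiff_comp_height hμ'2).differentiable (by norm_num)
    exact (((h1.mul hF2d).sub (h2.mul hθd)).sub (h3.mul (hθd.pow 2))).add ((h3.const_mul 4).mul hEd)
  have hwd : Differentiable ℝ w := by
    rw [hw]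
    refine Differentiable.inv ((((contDiff_comp_height hμt2).differentiable (by norm_num)).const_sub 1).const_mul 2)
      fun y => ?_
    have := hμ1 (y 2)
    intro h0; nlinarith
  have hFd : Differentiable ℝ F := hwd.mul hSd
  have hb2 : ∀ b : Fin 3, b ≠ 2 → (EuclideanSpace.single b (1 : ℝ) : EuclideanSpace ℝ (Fin 3)) 2 = 0 := by
    intro b hb; fin_cases b <;> simp_all
  have hwb : ∀ y, ∀ b : Fin 3, b ≠ 2 → fderiv ℝ w y (EuclideanSpace.single b 1) = 0 := by
    intro y b hb
    have hg : DifferentiableAt ℝ (fun ζ : ℝ => (2 * (1 - μ t ζ))⁻¹) (y 2) := by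
      refine (((hμd (y 2)).const_sub 1).const_mul 2).inv ?_
      have := hμ1 (y 2); intro h0; nlinarith
    have e : w = fun y : EuclideanSpace ℝ (Fin 3) => (fun ζ : ℝ => (2 * (1 - μ t ζ))⁻¹) (y 2) := by
      funext y; rw [hw]
    rw [e, fderiv_comp_height_apply hg, hb2 b hb, mul_zero]
  have hSb : ∀ y, ∀ b : Fin 3, b ≠ 2 → fderiv ℝ S y (EuclideanSpace.single b 1) = 0 := by
    intro y b hb
    have hloc : ∀ᶠ z in 𝓝 ((t, y) : ℝ × EuclideanSpace ℝ (Fin 3)), ∀ b : Fin 3, b ≠ 2 →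
        fderiv ℝ (v z.1) z.2 (EuclideanSpace.single 2 1) b =
          μ z.1 (z.2 2) * fderiv ℝ (v z.1) z.2 (EuclideanSpace.single b 1) 2 := by
      have hn : ∀ᶠ z : ℝ × EuclideanSpace ℝ (Fin 3) in 𝓝 (t, y), z.1 < 0 :=
        (continuous_fst.tendsto _).eventually (Iio_mem_nhds ht)
      filter_upwards [hn] with z hz using fun b hb => hslope z.1 hz z.2 b hb
    have h := horizFDeriv_weightSource_eq_zero hrate hcont hmild hdiv hpol hμ ht y hloc hb
    rw [hS]; exact h
  have hFb : ∀ y, ∀ b : Fin 3, b ≠ 2 → fderiv ℝ F y (EuclideanSpace.single b (1 : ℝ)) = 0 := by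
    intro y b hb
    rw [hF, fderiv_fun_mul (hwd y) (hSd y)]
    simp only [_root_.add_apply, FunLike.coe_smul, Pi.smul_apply, smul_eq_mul, hwb y b hb, hSb y b hb, mul_zero,
      add_zero]
  set d : EuclideanSpace ℝ (Fin 3) := x' - x with hd
  have hd2 : d 2 = 0 := by rw [hd]; simp [hxx']
  set γ : ℝ → ℝ := fun s => F (x + s • d) with hγ
  have hγd : ∀ s, HasDerivAt γ 0 s := by
    intro s
    have hline : HasDerivAt (fun s : ℝ => x + s • d) d s := by
      simpa using ((hasDerivAt_id s).smul_const d).const_add x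
    have h := (hFd (x + s • d)).hasFDerivAt.comp_hasDerivAt s hline
    have hzero : fderiv ℝ F (x + s • d) d = 0 := by
      rw [fderiv_apply_eq_sum]
      simp only [Fin.sum_univ_three, hFb _ 0 (by decide), hFb _ 1 (by decide), hd2, mul_zero, zero_mul, add_zero]
    rw [hzero] at h
    exact h
  have hconst := is_const_of_deriv_eq_zero (fun s => (hγd s).differentiableAt) (fun s => (hγd s).deriv) 0 1
  simp only [hγ, zero_smul, add_zero, one_smul] at hconst
  have hx' : x + d = x' := by rw [hd]; abel
  rw [hx'] at hconst
  have key : F x = F x' := hconst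
  have hne : ∀ y : EuclideanSpace ℝ (Fin 3), (1 : ℝ) - μ t (y 2) ≠ 0 := fun y => by
    have := hμ1 (y 2); intro h0; linarith
  have eF : ∀ y : EuclideanSpace ℝ (Fin 3), F y =
      (timeDerivWithin (Iio 0) v t y + convect (v t) (v t) y - Δ (v t) y) 2 -
        (1 - μ t (y 2))⁻¹ * ((deriv (fun s => μ s (y 2)) t - deriv (deriv (μ t)) (y 2)) * v t y 2 +
          deriv (μ t) (y 2) / 2 * v t y 2 ^ 2 -
          2 * deriv (μ t) (y 2) * fderiv ℝ (v t) y (EuclideanSpace.single 2 1) 2) := by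
    intro y
    have h1 : (1 : ℝ) - μ t (y 2) ≠ 0 := hne y
    have h2 : (2 : ℝ) * (1 - μ t (y 2)) ≠ 0 := mul_ne_zero two_ne_zero h1
    rw [hF, hw, hS]
    field_simp
    ring
  rw [← eF x, ← eF x']
  exact key

omit hrate hcont hmild hdiv in
include hslope in
/-- On (TH), at a point of height `x₂` with `μ(t,x₂) ≤ 1`, the Clebsch production
`∇_h v₂·(∇_h v₂ − ∂₂v_h) = (1 − μ(t,x₂))|∇_h v₂|²` is non-negative. -/
theorem prod_nonneg_TH {t : ℝ} (ht : t < 0) (hvd : Differentiable ℝ (v t)) (x : EuclideanSpace ℝ (Fin 3))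
    (hμle : μ t (x 2) ≤ 1) :
    0 ≤ fderiv ℝ (fun y => v t y 2) x (EuclideanSpace.single 0 (1 : ℝ)) *
          (fderiv ℝ (fun y => v t y 2) x (EuclideanSpace.single 0 (1 : ℝ)) - fderiv ℝ (v t) x (EuclideanSpace.single 2 (1 : ℝ)) 0) +
        fderiv ℝ (fun y => v t y 2) x (EuclideanSpace.single 1 (1 : ℝ)) *
          (fderiv ℝ (fun y => v t y 2) x (EuclideanSpace.single 1 (1 : ℝ)) - fderiv ℝ (v t) x (EuclideanSpace.single 2 (1 : ℝ)) 1) := by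
  rw [fderiv_coord_apply (hvd x) 2, fderiv_coord_apply (hvd x) 2, hslope t ht x 0 (by decide),
    hslope t ht x 1 (by decide)]
  have h1 : 0 ≤ 1 - μ t (x 2) := by linarith
  nlinarith [sq_nonneg (fderiv ℝ (v t) x (EuclideanSpace.single 0 (1 : ℝ)) 2),
    sq_nonneg (fderiv ℝ (v t) x (EuclideanSpace.single 1 (1 : ℝ)) 2),
    mul_nonneg h1 (sq_nonneg (fderiv ℝ (v t) x (EuclideanSpace.single 0 (1 : ℝ)) 2)),
    mul_nonneg h1 (sq_nonneg (fderiv ℝ (v t) x (EuclideanSpace.single 1 (1 : ℝ)) 2))]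

include hslope in
/-- On (TH) with `μ(t,·) ≤ 1` the averaged production `Dsep(t,z)` is non-negative. -/
theorem sliceDsep_nonneg_TH {t : ℝ} (ht : t < 0) (hμle : ∀ ζ, μ t ζ ≤ 1) (z : ℝ) : 0 ≤ sliceDsep φ R v t z := by
  have hA : IsTypeIAncientMild C v := isTypeIAncientMild_of_class hrate hcont hmild hdiv
  have hvd : Differentiable ℝ (v t) := (hA.contDiff_slice ht).differentiable (by simp)
  exact hmean_nonneg φ 0 R z fun x => prod_nonneg_TH hslope ht hvd x (hμle (x 2))

include hpol hμ hslope in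
/-- **(TH-KEY)**: for a profile of the class on the stratum (TH) (normal form with slope `μ(t,x₂)`, `μ ∈ C³`,
`μ(t,·) < 1`) and gradient rate `C₁`, at every height `z`, with `Λ = 1/(1−μ(t,z))`, `μ_t = ∂ₜμ(t,z)`, `μ_z, μ_zz` the
height derivatives:
`∂ₜV − 2Λ(μ_t − μ_zz)V − Λμ_z(⟨v₂³⟩ − ⟨v₂⟩⟨v₂²⟩) + 4Λμ_z(⟨v₂∂₂v₂⟩ − ⟨v₂⟩⟨∂₂v₂⟩) + 2∂_zG + 2Dsep ≤ R⁻¹(8M₀³ + 8M₀M₁)K`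
(K2-p2's `key_mean_sep` with the slot `θt = ∂ₜv₂ − Λ[(μ_t−μ_zz)v₂ + (μ_z/2)v₂² − 2μ_z∂₂v₂]` and the height-only source of
`residual_TH_eq_of_height_eq`). -/
theorem key_slice_TH {t : ℝ} (ht : t < 0) (hμ1 : ∀ ζ, μ t ζ < 1)
    {C₁ : ℝ} (hC₁ : ∀ t < 0, ∀ y, ‖fderiv ℝ (v t) y‖ ≤ C₁ / (-t)) (hR : 0 < R) (z : ℝ) :
    sliceVt φ R v t z
      - 2 * ((1 - μ t z)⁻¹ * (deriv (fun s => μ s z) t - deriv (deriv (μ t)) z)) * sliceV φ R v t z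
      - (1 - μ t z)⁻¹ * deriv (μ t) z *
          (hmean φ 0 R z (fun x => v t x 2 ^ 3) - sliceM φ R v t z * sliceE φ R v t z)
      + 4 * ((1 - μ t z)⁻¹ * deriv (μ t) z) *
          (hmean φ 0 R z (fun x => v t x 2 * fderiv ℝ (v t) x (EuclideanSpace.single 2 1) 2)
            - sliceM φ R v t z * hmean φ 0 R z (fun x => fderiv ℝ (v t) x (EuclideanSpace.single 2 1) 2))
      + 2 * sliceGz φ R v t z + 2 * sliceDsep φ R v t z ≤
      R⁻¹ * (8 * (C / Real.sqrt (-t) * (C / Real.sqrt (-t)) * (C / Real.sqrt (-t))) +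
        8 * (C / Real.sqrt (-t) * (C₁ / (-t)))) * bumpK φ := by
  have hA : IsTypeIAncientMild C v := isTypeIAncientMild_of_class hrate hcont hmild hdiv
  have hu : ContDiff ℝ 2 (v t) := (hA.contDiff_slice ht).of_le (by norm_cast)
  have hdiv' := fun x => div_coord (hdiv t ht) x
  have hμt2 : ContDiff ℝ 2 (μ t) := (hμ.comp (contDiff_const.prodMk contDiff_id)).of_le (by norm_cast)
  have hμt3 : ContDiff ℝ 3 (μ t) := hμ.comp (contDiff_const.prodMk contDiff_id)
  have hμ'2 : ContDiff ℝ 2 (deriv (μ t)) :=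
    (contDiff_succ_iff_deriv.1 (hμt3 : ContDiff ℝ ((2 : ℕ∞) + 1 : ℕ∞) (μ t))).2.2
  have hμ''1 : ContDiff ℝ 1 (deriv (deriv (μ t))) :=
    (contDiff_succ_iff_deriv.1 (hμ'2 : ContDiff ℝ ((1 : ℕ∞) + 1 : ℕ∞) (deriv (μ t)))).2.2
  have hμ2 : ContDiff ℝ 2 (uncurry μ) := hμ.of_le (by norm_cast)
  -- the height coefficients as continuous functions on `ℝ³`
  obtain ⟨Mt, hMt⟩ : ∃ Mt : ℝ → ℝ, ∀ ζ, Mt ζ = deriv (fun s => μ s ζ) t := ⟨_, fun _ => rfl⟩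
  have hMt_eq : Mt = fun ζ => fderiv ℝ (uncurry μ) (t, ζ) (1, 0) := funext fun ζ => by
    rw [hMt]; exact (hasDerivAt_timeSlice_of_uncurry ((hμ2.differentiable (by norm_num)) (t, ζ))).deriv
  have hMtc : Continuous Mt := by
    rw [hMt_eq]
    exact (((hμ.fderiv_right (m := 2) (by norm_cast)).clm_apply contDiff_const).comp
      (contDiff_const.prodMk contDiff_id)).continuous
  set k₁ : ℝ → ℝ := fun ζ => (1 - μ t ζ)⁻¹ * (Mt ζ - deriv (deriv (μ t)) ζ) with hk₁
  set k₂ : ℝ → ℝ := fun ζ => (1 - μ t ζ)⁻¹ * (deriv (μ t) ζ / 2) with hk₂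
  set k₃ : ℝ → ℝ := fun ζ => (1 - μ t ζ)⁻¹ * (2 * deriv (μ t) ζ) with hk₃
  have h1c : Continuous fun ζ : ℝ => (1 : ℝ) - μ t ζ := continuous_const.sub hμt2.continuous
  have hinvc : Continuous fun ζ => (1 - μ t ζ)⁻¹ := h1c.inv₀ fun ζ => (sub_pos.2 (hμ1 ζ)).ne'
  have hk₁c : Continuous k₁ := hinvc.mul (hMtc.sub hμ''1.continuous)
  have hk₂c : Continuous k₂ := hinvc.mul (hμ'2.continuous.div_const 2)
  have hk₃c : Continuous k₃ := hinvc.mul (continuous_const.mul hμ'2.continuous)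
  have hπ : Continuous fun x : EuclideanSpace ℝ (Fin 3) => x 2 :=
    (EuclideanSpace.proj (𝕜 := ℝ) (2 : Fin 3) : EuclideanSpace ℝ (Fin 3) →L[ℝ] ℝ).continuous
  have hk₁x : Continuous fun x : EuclideanSpace ℝ (Fin 3) => k₁ (x 2) := hk₁c.comp hπ
  have hk₂x : Continuous fun x : EuclideanSpace ℝ (Fin 3) => k₂ (x 2) := hk₂c.comp hπ
  have hk₃x : Continuous fun x : EuclideanSpace ℝ (Fin 3) => k₃ (x 2) := hk₃c.comp hπ
  have hθc : Continuous (fun x => v t x 2) := (contDiff_coord hu 2).continuous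
  have hvtc : Continuous (fun x => deriv (fun s => v s x) t 2) := (contDiff_vertT hrate hcont hmild hdiv ht).continuous
  have hEc : Continuous (fun x => fderiv ℝ (v t) x (EuclideanSpace.single 2 1) 2) :=
    (contDiff_fderiv_coord hrate hcont hmild hdiv ht (EuclideanSpace.single 2 1) 2).continuous
  -- the slot `θt = ∂ₜv₂ − k₁(x₂) v₂ − k₂(x₂) v₂² + k₃(x₂) ∂₂v₂`
  set θt : EuclideanSpace ℝ (Fin 3) → ℝ := fun x => deriv (fun s => v s x) t 2
      - k₁ (x 2) * v t x 2 - k₂ (x 2) * v t x 2 ^ 2 + k₃ (x 2) * fderiv ℝ (v t) x (EuclideanSpace.single 2 1) 2 with hθt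
  have hθtc : Continuous θt :=
    ((hvtc.sub (hk₁x.mul hθc)).sub (hk₂x.mul (hθc.pow 2))).add (hk₃x.mul hEc)
  -- the height-only source `g(ζ) = F(ζ e₂)`
  set g : ℝ → ℝ := fun ζ => (timeDerivWithin (Iio 0) v t (ζ • EuclideanSpace.single 2 (1 : ℝ)) +
      convect (v t) (v t) (ζ • EuclideanSpace.single 2 (1 : ℝ)) - Δ (v t) (ζ • EuclideanSpace.single 2 (1 : ℝ))) 2
      - (k₁ ζ * v t (ζ • EuclideanSpace.single 2 (1 : ℝ)) 2 + k₂ ζ * v t (ζ • EuclideanSpace.single 2 (1 : ℝ)) 2 ^ 2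
        - k₃ ζ * fderiv ℝ (v t) (ζ • EuclideanSpace.single 2 (1 : ℝ)) (EuclideanSpace.single 2 1) 2) with hg
  have heq : ∀ x, θt x + fderiv ℝ (fun y => v t y 2) x (v t x) -
      ∑ i : Fin 3, fderiv ℝ (fun y => fderiv ℝ (fun y' => v t y' 2) y (EuclideanSpace.single i (1 : ℝ))) x
        (EuclideanSpace.single i (1 : ℝ)) = g (x 2) := by
    intro x
    have hv := vertical_equation_coord hrate hcont hmild hdiv ht x
    have hh := residual_TH_eq_of_height_eq hrate hcont hmild hdiv hpol hμ hslope ht hμ1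
      (x := x) (x' := x 2 • EuclideanSpace.single 2 (1 : ℝ)) (by simp)
    have e2 : (x 2 • EuclideanSpace.single 2 (1 : ℝ) : EuclideanSpace ℝ (Fin 3)) 2 = x 2 := by simp
    rw [e2] at hh
    rw [hθt, hg, hk₁, hk₂, hk₃]
    dsimp only
    rw [← (hasDerivAt_vert hrate hcont hmild hdiv ht x).deriv]
    rw [← hMt] at hh
    linear_combination hv + hh
  have key := key_mean_sep φ 0 z hu hdiv' (fun x => hrate t ht x) (hC₁ t ht) hθtc heq hR
  -- expand the two means containing `θt`; the coefficients are constant on the plane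
  -- (every step states its functions explicitly, so that `hmean_sub`/`hmean_add` elaborate against them)
  have hθ2c : Continuous fun x : EuclideanSpace ℝ (Fin 3) => 2 * v t x 2 * deriv (fun s => v s x) t 2 :=
    (continuous_const.mul hθc).mul hvtc
  have hB1 : Continuous fun x : EuclideanSpace ℝ (Fin 3) => k₁ (x 2) * (2 * v t x 2 ^ 2) :=
    hk₁x.mul (continuous_const.mul (hθc.pow 2))
  have hB2 : Continuous fun x : EuclideanSpace ℝ (Fin 3) => k₂ (x 2) * (2 * v t x 2 ^ 3) :=
    hk₂x.mul (continuous_const.mul (hθc.pow 3))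
  have hB3 : Continuous fun x : EuclideanSpace ℝ (Fin 3) =>
      k₃ (x 2) * (2 * (v t x 2 * fderiv ℝ (v t) x (EuclideanSpace.single 2 1) 2)) :=
    hk₃x.mul (continuous_const.mul (hθc.mul hEc))
  have e1 : hmean φ 0 R z (fun x => 2 * v t x 2 * θt x) =
      hmean φ 0 R z (fun x => 2 * v t x 2 * deriv (fun s => v s x) t 2)
        - 2 * k₁ z * hmean φ 0 R z (fun x => v t x 2 ^ 2)
        - 2 * k₂ z * hmean φ 0 R z (fun x => v t x 2 ^ 3)
        + 2 * k₃ z * hmean φ 0 R z (fun x => v t x 2 * fderiv ℝ (v t) x (EuclideanSpace.single 2 1) 2) := by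
    have hfun : (fun x => 2 * v t x 2 * θt x) = fun x =>
        2 * v t x 2 * deriv (fun s => v s x) t 2 - k₁ (x 2) * (2 * v t x 2 ^ 2)
          - k₂ (x 2) * (2 * v t x 2 ^ 3)
          + k₃ (x 2) * (2 * (v t x 2 * fderiv ℝ (v t) x (EuclideanSpace.single 2 1) 2)) := by
      funext x; rw [hθt]; ring
    have s1 : hmean φ 0 R z (fun x => 2 * v t x 2 * deriv (fun s => v s x) t 2 - k₁ (x 2) * (2 * v t x 2 ^ 2)
          - k₂ (x 2) * (2 * v t x 2 ^ 3)
          + k₃ (x 2) * (2 * (v t x 2 * fderiv ℝ (v t) x (EuclideanSpace.single 2 1) 2))) =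
        hmean φ 0 R z (fun x => 2 * v t x 2 * deriv (fun s => v s x) t 2 - k₁ (x 2) * (2 * v t x 2 ^ 2)
          - k₂ (x 2) * (2 * v t x 2 ^ 3))
        + hmean φ 0 R z (fun x => k₃ (x 2) * (2 * (v t x 2 * fderiv ℝ (v t) x (EuclideanSpace.single 2 1) 2))) :=
      hmean_add φ 0 R z ((hθ2c.sub hB1).sub hB2) hB3
    have s2 : hmean φ 0 R z (fun x => 2 * v t x 2 * deriv (fun s => v s x) t 2 - k₁ (x 2) * (2 * v t x 2 ^ 2)
          - k₂ (x 2) * (2 * v t x 2 ^ 3)) =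
        hmean φ 0 R z (fun x => 2 * v t x 2 * deriv (fun s => v s x) t 2 - k₁ (x 2) * (2 * v t x 2 ^ 2))
        - hmean φ 0 R z (fun x => k₂ (x 2) * (2 * v t x 2 ^ 3)) :=
      hmean_sub φ 0 R z (hθ2c.sub hB1) hB2
    have s3 : hmean φ 0 R z (fun x => 2 * v t x 2 * deriv (fun s => v s x) t 2 - k₁ (x 2) * (2 * v t x 2 ^ 2)) =
        hmean φ 0 R z (fun x => 2 * v t x 2 * deriv (fun s => v s x) t 2)
        - hmean φ 0 R z (fun x => k₁ (x 2) * (2 * v t x 2 ^ 2)) :=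
      hmean_sub φ 0 R z hθ2c hB1
    rw [hfun, s1, s2, s3, hmean_height_mul k₁ (fun x => 2 * v t x 2 ^ 2) z,
      hmean_height_mul k₂ (fun x => 2 * v t x 2 ^ 3) z,
      hmean_height_mul k₃ (fun x => 2 * (v t x 2 * fderiv ℝ (v t) x (EuclideanSpace.single 2 1) 2)) z,
      hmean_const_mul φ 0 R z (fun x => v t x 2 ^ 2) 2, hmean_const_mul φ 0 R z (fun x => v t x 2 ^ 3) 2,
      hmean_const_mul φ 0 R z (fun x => v t x 2 * fderiv ℝ (v t) x (EuclideanSpace.single 2 1) 2) 2]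
    ring
  have hC1 : Continuous fun x : EuclideanSpace ℝ (Fin 3) => k₁ (x 2) * v t x 2 := hk₁x.mul hθc
  have hC2 : Continuous fun x : EuclideanSpace ℝ (Fin 3) => k₂ (x 2) * v t x 2 ^ 2 := hk₂x.mul (hθc.pow 2)
  have hC3 : Continuous fun x : EuclideanSpace ℝ (Fin 3) =>
      k₃ (x 2) * fderiv ℝ (v t) x (EuclideanSpace.single 2 1) 2 := hk₃x.mul hEc
  have e2 : hmean φ 0 R z θt =
      hmean φ 0 R z (fun x => deriv (fun s => v s x) t 2)
        - k₁ z * hmean φ 0 R z (fun x => v t x 2)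
        - k₂ z * hmean φ 0 R z (fun x => v t x 2 ^ 2)
        + k₃ z * hmean φ 0 R z (fun x => fderiv ℝ (v t) x (EuclideanSpace.single 2 1) 2) := by
    have s1 : hmean φ 0 R z (fun x => deriv (fun s => v s x) t 2 - k₁ (x 2) * v t x 2 - k₂ (x 2) * v t x 2 ^ 2
          + k₃ (x 2) * fderiv ℝ (v t) x (EuclideanSpace.single 2 1) 2) =
        hmean φ 0 R z (fun x => deriv (fun s => v s x) t 2 - k₁ (x 2) * v t x 2 - k₂ (x 2) * v t x 2 ^ 2)
        + hmean φ 0 R z (fun x => k₃ (x 2) * fderiv ℝ (v t) x (EuclideanSpace.single 2 1) 2) :=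
      hmean_add φ 0 R z ((hvtc.sub hC1).sub hC2) hC3
    have s2 : hmean φ 0 R z (fun x => deriv (fun s => v s x) t 2 - k₁ (x 2) * v t x 2 - k₂ (x 2) * v t x 2 ^ 2) =
        hmean φ 0 R z (fun x => deriv (fun s => v s x) t 2 - k₁ (x 2) * v t x 2)
        - hmean φ 0 R z (fun x => k₂ (x 2) * v t x 2 ^ 2) :=
      hmean_sub φ 0 R z (hvtc.sub hC1) hC2
    have s3 : hmean φ 0 R z (fun x => deriv (fun s => v s x) t 2 - k₁ (x 2) * v t x 2) =
        hmean φ 0 R z (fun x => deriv (fun s => v s x) t 2) - hmean φ 0 R z (fun x => k₁ (x 2) * v t x 2) :=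
      hmean_sub φ 0 R z hvtc hC1
    rw [hθt, s1, s2, s3, hmean_height_mul k₁ (fun x => v t x 2) z, hmean_height_mul k₂ (fun x => v t x 2 ^ 2) z,
      hmean_height_mul k₃ (fun x => fderiv ℝ (v t) x (EuclideanSpace.single 2 1) 2) z]
  rw [e1, e2] at key
  have hk1z : k₁ z = (1 - μ t z)⁻¹ * (deriv (fun s => μ s z) t - deriv (deriv (μ t)) z) := by
    simp only [hk₁, hMt]
  have hk2z : k₂ z = (1 - μ t z)⁻¹ * (deriv (μ t) z / 2) := rfl
  have hk3z : k₃ z = (1 - μ t z)⁻¹ * (2 * deriv (μ t) z) := rfl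
  rw [hk1z, hk2z, hk3z] at key
  unfold sliceVt sliceGz sliceDsep sliceV sliceM sliceE at *
  linarith [key]

end Class

end Summit.NavierStokesRegularity.NavierStokesRegularity.Theorems.PoloidalWindowDoorPoloidalWindowRigidityTimeHeightShearVariance

end
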